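import Mathlib
import HarnessLib
import Literature.Analysis.FluidPDE.SelfSimilar
import Literature.Analysis.FluidPDE.SelfSimilarLiouville
import Literature.Analysis.FluidPDE.KNSSAxisymmetricNoSwirlHolds
import Literature.Analysis.FluidPDE.AxisymmetricEuler
import Literature.Analysis.FluidPDE.AxisymmetricVorticityTransport
import Literature.Analysis.FluidPDE.ClassicalSolution
import Literature.Analysis.FluidPDE.ClassicalSolutionCalculus
import Literature.Analysis.FluidPDE.MildSolutionIsometryCovariance
import Literature.Analysis.FluidPDE.KatoSymmetryCovariance
import Literature.Analysis.FluidPDE.VorticityCalculus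
import Summits.NavierStokesRegularity.NavierStokesRegularity.Theorems.UnthreadedDoorNetFluxDefs
import Summits.NavierStokesRegularity.NavierStokesRegularity.Theorems.UnthreadedDoorCellFluxZDefs

/-!
# Route `UnthreadedDoor`, crux `PoloidalLiouville` (stmt-NavierStokesRegularity-1222), WALL W1 — cell-flux Z skeleton, stub Z-3
# `KNSSTransfer` PROVED (`Cruxes/PoloidalLiouville/CellFluxZSkeleton.lean` v1.1 c6ae0be7f8d8, custodian ns-idea-14 g6; critic ns-wall-crit-1 V22)

`knssTransfer : CellFlux.KNSSTransfer` (the Theorems-side twin of the skeleton's `ZSkeleton.KNSSTransfer`, bodies VERBATIM): if a bounded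
ancient mild solution `v` (`ν = 1`, the tree's duality class) with a.e.-strongly measurable slices, jointly smooth on `(-∞,0) × ℝ³`, is — at every
time `t ≤ t₁ < 0` — axisymmetric WITHOUT SWIRL about the axis through `x₀` straightened by ONE fixed frame `R`, then it is irrotational at every
`t ≤ t₁`.

PROOF («KNSS Thm 5.2 in a moving frame», the skeleton's recipe; every input is in the tree).
* The field `u s y := R (v (s + t₁) (R⁻¹ y + x₀))`, `s < 0`, is again a bounded ancient mild solution: translation covariance of the duality
  class (`IsWeaklyDivFree.comp_sub_right`, `IsMildNSSolutionBetween.comp_sub_right_zero`, Kato symmetry file), isometry covariance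
  (`IsBoundedAncientMildSolution.conj_linearIsometryEquiv`) and the time shift by `t₁ ≤ 0` (`IsAncientMildSolution.time_translate`); its slices
  are continuous (joint smoothness), hence measurable, and by hypothesis axisymmetric without swirl at every `s < 0`.
* KNSS 2009 Thm 5.2, PROVED in the tree in the slice-wise class (`knss_axisymmetric_no_swirl'_holds`): every slice `u s` is a.e. a constant,
  hence (continuity) constant; undoing the frame, `v t` is constant for every `t < t₁`, so `curl (v t) ≡ 0` there.
* At `t = t₁`: `t ↦ curl (v t) x` is continuous on `(-∞,0)` (`IsSmoothSpaceTimeOn.isSmoothSpaceTimeOn_vorticity`) and vanishes on `(-∞, t₁)`.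

WHAT THIS IS NOT: one of four stubs of Z (`ZonalUnthreadedVorticityVanishes`), itself information-grade for W1 (critic V22-P6 (a): «KNSS Thm 5.2
in a moving frame», W1 movement 0); `PoloidalLiouville` (1222), Z, W1 and NS regularity stay OPEN.  `--supports stmt-NavierStokesRegularity-1222
--as helper`.  [folklore]
-/

noncomputable section

-- the summit and its single sub-problem share the name (CONVENTIONS §1)
set_option linter.dupNamespace false

open Set Function Filter Topology MeasureTheory Metric

namespace Summit.NavierStokesRegularity.NavierStokesRegularity.Theorems.PoloidalLiouville.CellFlux

open Summit.NavierStokesRegularity.NavierStokesRegularity.Theorems.PoloidalLiouville.NetFlux (E3)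
open Literature.Analysis Literature.Analysis.FluidPDE

/-! ### The class is invariant under the frame change `y ↦ R (v (s + t₁) (R⁻¹ y + x₀))` -/

/-- **Euclidean + time-shift covariance of the bounded ancient mild class**: for a linear isometry `R`, a centre `x₀` and a time `t₁ ≤ 0`, the field
`(s, y) ↦ R (v (s + t₁) (R⁻¹ y + x₀))` is a bounded ancient mild solution whenever `v` is (translation: Kato symmetry file; isometry:
`IsBoundedAncientMildSolution.conj_linearIsometryEquiv`; time shift: `IsAncientMildSolution.time_translate`). [folklore] -/
theorem isBoundedAncientMildSolution_frame {ν : ℝ} {v : ℝ → E3 → E3} (hB : IsBoundedAncientMildSolution ν v)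
    (R : E3 ≃ₗᵢ[ℝ] E3) (x₀ : E3) {t₁ : ℝ} (ht₁ : t₁ ≤ 0) :
    IsBoundedAncientMildSolution ν (fun s y => R (v (s + t₁) (R.symm y + x₀))) := by
  -- translation by `x₀`
  have hB1 : IsBoundedAncientMildSolution ν (fun s y => v s (y + x₀)) := by
    have e : (fun s y => v s (y + x₀)) = fun s y => v s (y - -x₀) := by
      funext s y
      rw [sub_neg_eq_add]
    rw [e]
    obtain ⟨⟨hdiv, hmild⟩, K, hK⟩ := hB
    exact ⟨⟨fun s hs => (hdiv s hs).comp_sub_right (-x₀), fun s s' hss' hs' => (hmild s s' hss' hs').comp_sub_right_zero (-x₀)⟩,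
      K, fun s hs y => hK s hs _⟩
  -- conjugation by `R`
  have hB2 : IsBoundedAncientMildSolution ν (fun s y => R (v s (R.symm y + x₀))) := hB1.conj_linearIsometryEquiv R
  -- time shift by `t₁ ≤ 0`
  refine ⟨hB2.1.time_translate ht₁, ?_⟩
  obtain ⟨K, hK⟩ := hB2.2
  refine ⟨K, fun s hs y => hK (s + t₁) ?_ y⟩
  have hs' : s < 0 := hs
  show s + t₁ < 0
  linarith

/-! ### Z-3 -/

/-- **Z-3 `KNSSTransfer` (cell-flux Z skeleton v1.1; the Theorems-side twin `CellFlux.KNSSTransfer`, body VERBATIM).**  A bounded ancient mild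
solution (`ν = 1`) with a.e.-strongly measurable slices, jointly smooth on `(-∞,0) × ℝ³`, axisymmetric WITHOUT swirl about the axis through `x₀` in ONE
fixed frame `R` at every `t ≤ t₁ < 0`, is irrotational at every `t ≤ t₁`: frame change into the tree's KNSS class, KNSS 2009 Thm 5.2 (PROVED,
`knss_axisymmetric_no_swirl'_holds`) ⇒ constant slices for `t < t₁`, and `t = t₁` by continuity of the vorticity in time.
[cite: KochNadirashviliSereginSverak2009, Thm 5.2 (arXiv:0709.3599 pp. 9–10)] -/
theorem knssTransfer : KNSSTransfer := by
  intro v x₀ hB hmeas hsmooth t₁ ht₁ R hax t ht x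
  have hsm : IsSmoothSpaceTimeOn (Iio 0) v := hsmooth
  -- the field in the straightened frame, shifted so that `t₁` becomes `0`
  set u : ℝ → E3 → E3 := fun s y => R (v (s + t₁) (R.symm y + x₀)) with hu
  have hBu : IsBoundedAncientMildSolution 1 u := isBoundedAncientMildSolution_frame hB R x₀ ht₁.le
  have hvc : ∀ s < 0, Continuous (v s) := fun s hs => (hsm.contDiff_slice hs).continuous
  have huc : ∀ s < 0, Continuous (u s) := fun s hs =>
    R.continuous.comp ((hvc (s + t₁) (by linarith)).comp (R.symm.continuous.add continuous_const))
  have humeas : ∀ s < 0, AEStronglyMeasurable (u s) volume := fun s hs => (huc s hs).aestronglyMeasurable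
  have hax' : ∀ s < 0, IsAxisymmetric (u s) := fun s hs => (hax (s + t₁) (by linarith)).1
  have hsw' : ∀ s < 0, HasNoSwirl (u s) := fun s hs => (hax (s + t₁) (by linarith)).2
  -- KNSS 2009 Thm 5.2: every slice of `u` is a.e. constant, hence constant; undo the frame
  have hconst : ∀ s < 0, ∃ b : E3, v (s + t₁) = fun _ => b := by
    intro s hs
    obtain ⟨b, hb⟩ := knss_axisymmetric_no_swirl'_holds hBu humeas hax' hsw' s hs
    have hub : u s = fun _ => b := ((huc s hs).ae_eq_iff_eq volume continuous_const).1 hb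
    refine ⟨R.symm b, funext fun y => ?_⟩
    have h1 := congr_fun hub (R (y - x₀))
    simp only [hu, LinearIsometryEquiv.symm_apply_apply, sub_add_cancel] at h1
    rw [← h1, LinearIsometryEquiv.symm_apply_apply]
  -- irrotational strictly before `t₁`
  have hlt : ∀ s < t₁, ∀ y, curl (v s) y = 0 := by
    intro s hs y
    obtain ⟨b, hb⟩ := hconst (s - t₁) (by linarith)
    rw [sub_add_cancel] at hb
    rw [hb]
    exact curl_eq_zero_of_fderiv_eq_zero (by simp)
  by_cases hlt' : t < t₁
  · exact hlt t hlt' x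
  -- `t = t₁`: continuity of the vorticity in time
  have heq : t = t₁ := le_antisymm ht (not_lt.1 hlt')
  subst heq
  have hvort : IsSmoothSpaceTimeOn (Iio 0) (vorticity v) := hsm.isSmoothSpaceTimeOn_vorticity (uniqueDiffOn_Iio 0)
  have hg : ContinuousOn (fun s => curl (v s) x) (Iio 0) :=
    hvort.continuousOn.comp (continuousOn_id.prodMk continuousOn_const) fun s hs => ⟨hs, mem_univ _⟩
  have hga : ContinuousAt (fun s => curl (v s) x) t := hg.continuousAt (Iio_mem_nhds ht₁)
  have h1 : Tendsto (fun s => curl (v s) x) (𝓝[<] t) (𝓝 (curl (v t) x)) :=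
    hga.tendsto.mono_left nhdsWithin_le_nhds
  have h2 : Tendsto (fun s => curl (v s) x) (𝓝[<] t) (𝓝 0) := by
    refine tendsto_const_nhds.congr' ?_
    filter_upwards [self_mem_nhdsWithin] with s hs
    exact (hlt s hs x).symm
  exact tendsto_nhds_unique h1 h2

end Summit.NavierStokesRegularity.NavierStokesRegularity.Theorems.PoloidalLiouville.CellFlux

end
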